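import Mathlib
import HarnessLib
import Summits.Langlands.Statement
import Summits.Langlands.Langlands.Theses.CoreAdequacySplit
import Summits.Langlands.Langlands.Theorems.CoreAdequacySplitKernel
import Literature.NumberTheory.GaloisRepresentations.ResidualGaloisRep
import Literature.NumberTheory.GaloisRepresentations.AdequateSubgroup

/-!
# LieDefectSplit — kernel support module (tree twin, PART 1 = §1–§5 of the decomp-langlands lens-5 gen-12 node `LieDefectSplit`;
`--supports stmt-Langlands-27954`)

Node of record: HOME/nodes/lens-5-g12-LieDefectSplit.lean (sha256 0f5c83370f5e…, 546 lines; NODE L1043 / OFFER L1044 on the cell bus, crit-1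
CLEARED row 208 (L1046); filed as route-Langlands-LieDefectSplit rev 0 @b90edff92738 (ROUTE-BORN L1049: LIE 28415 · DEG 28416 · TRANS↓ 28417 ·
FRAME′ 28418 · Assembly 28419 + 7 dedup); memo nodes/lens-5-g12-LieDefectSplit.md; RUNME STEP T).  This file is the node with `import HarnessLib.Audit` dropped, the 118-line header abridged
(the header's tags / engine analysis / barrier placement / instruments live in the node and the memo) and §6 (the child-route one-liners
`…Theorems.LieDefectInline`, identical by `Iff.rfl` to the structured cells below) left for PART 2; §1–§5 below are VERBATIM.

TARGET = RSL `Summit.Langlands.Langlands.Theses.CoreAdequacySplit.NoAdequateLayerLifting` (stmt-Langlands-27954; crux rank 2, the DECLARED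
RESIDUAL of route-Langlands-CoreAdequacySplit rev 1): K a number field, 0 < n, IH below n, ℓ < 2(n+1), ρ : Γ_K → GL_n(ℚ̄_ℓ) framed with
ρ̄|Γ_{K(ζ_ℓ)} absolutely irreducible, NOT Thorne-adequate and with NO adequate solvable layer, not solvably reducible / mated ⟹ `LiftTail ρ`
(`rsl_route_iff_tree : CoreAdequacySplit.NoAdequateLayerLifting ↔ Theorems.CoreAdequacy.NoAdequateLayerLifting := Iff.rfl`).
CUT by the FAILURE MODE of adequacy above the perfect core: quasi-adequacy `IsQuasiAdequate` = Thorne's clauses (i) Hom(J,k)=0, (ii) (ad⁰)^J = 0,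
(iv) eigen-projection (field texts of the tree's `Subgroup.IsThorneAdequate` verbatim, (iii) H¹(J, ad⁰)=0 omitted); dial SQAL
`SolvablyQuasiAdequateImage ρ` (some absolutely irreducible J above the perfect core is quasi-adequate); carve D↓ `SolvableDescentShadow ρ`
(critic row 189 (F2): ρ a twist of the restriction along a solvable Galois K/K₀ of an irreducible geometric ρ₀ with ADQ ∨ SADQ); cells
SBL↓ `DescentShadowLifting` (RSL ∧ D↓; closed by the support TRANS↓ `SolvableDescentTransport` from the parent's binders), LIE
`LieObstructedLifting` (RSL ∧ ¬D↓ ∧ SQAL: the only defect of the quasi-adequate layer is a Lie class in H¹(J, ad⁰) — `lie_layer_of_instance`),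
DEG `DegenerateLayerLifting` (RSL ∧ ¬D↓ ∧ ¬SQAL: declared residual; the slab ℓ ∣ n is never quasi-adequate —
`not_solvablyQuasiAdequateImage_of_natCast_eq_zero`), FRAME′ `NoAdequateLayerFrame := RSL → Langlands`.  KERNEL `rsl_iff_cells :
RSL ↔ LIE ∧ DEG ∧ SBL↓` OUTRIGHT (two excluded middles, 0 EQUIV), `shadow_of_transport`, ROOT `closes` / `closes_framed` through the parent's
`CoreAdequacySplit.closes`, necessity `Cert.*`.  Census instrument (STEP G, the SQAL column of the RSL finite-group table): GAP job j341698.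
Nothing here proves `Langlands` (rung 0).
-/

set_option linter.dupNamespace false

namespace Summit.Langlands.Langlands.Theorems.CoreAdequacy.LieDefect

open Filter
open scoped MatrixGroups
open Literature.NumberTheory.GaloisRepresentations
open Summit.Langlands.Langlands.Theses

universe u

/-! ## §1 Group theory: quasi-adequacy (Thorne-adequacy minus the H¹ clause) and layers above the perfect core -/

section QuasiAdequate

variable {k : Type u} [Field k] {n : ℕ}

/-- **Quasi-adequate** subgroup `H ≤ GL_n(k)`: clauses (i) `Hom(H, k) = 0`, (ii) `(ad⁰)^H = 0` and (iv) eigen-spanning of Thorne-adequacy — the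
field statements of the tree's `Subgroup.IsThorneAdequate` VERBATIM — with the cohomological clause (iii) `H¹(H, ad⁰) = 0` OMITTED.  First-order over
tree constants, so that the dial inlines into a route one-liner. -/
def IsQuasiAdequate (H : Subgroup (GL (Fin n) k)) : Prop :=
  (∀ f : Additive H →+ k, f = 0) ∧ (Subgroup.adZeroRep H).invariants = ⊥ ∧
    ∀ W : Subrepresentation (Subgroup.adZeroRep H), IsAtom W → ∃ h : H, (orderOf h.1).Coprime (ringChar k) ∧
      ∃ α : k, ∃ w ∈ W, (eigenprojectionMatrix (h.1 : Matrix (Fin n) (Fin n) k) α * w.1).trace ≠ 0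

/-- Clause (iii) alone: `H¹(H, ad⁰) = 0` (every inhomogeneous 1-cocycle is a 1-coboundary), the field statement of `Subgroup.IsThorneAdequate`. -/
def H1AdZeroVanishes (H : Subgroup (GL (Fin n) k)) : Prop :=
  groupCohomology.cocycles₁ (Rep.of (Subgroup.adZeroRep H)) ≤ groupCohomology.coboundaries₁ (Rep.of (Subgroup.adZeroRep H))

/-- **Thorne-adequate ⟺ quasi-adequate ∧ H¹(H, ad⁰) = 0** (the four clauses regrouped; definitional). -/
theorem isThorneAdequate_iff_quasi_and_h1 (H : Subgroup (GL (Fin n) k)) :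
    Subgroup.IsThorneAdequate H ↔ IsQuasiAdequate H ∧ H1AdZeroVanishes H :=
  ⟨fun h => ⟨⟨h.addMonoidHom_eq_zero, h.invariants_eq_bot, h.exists_trace_eigenprojection_ne_zero⟩, h.cocycles₁_le_coboundaries₁⟩,
    fun h => ⟨h.1.1, h.1.2.1, h.2, h.1.2.2⟩⟩

/-- Adequate ⟹ quasi-adequate. -/
theorem IsQuasiAdequate.of_isThorneAdequate {H : Subgroup (GL (Fin n) k)} (h : Subgroup.IsThorneAdequate H) : IsQuasiAdequate H :=
  ((isThorneAdequate_iff_quasi_and_h1 H).1 h).1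

/-- **DEFECT LOCALISATION.**  On a quasi-adequate group, inadequacy IS the Lie obstruction: `¬ adequate ↔ H¹(H, ad⁰) ≠ 0`. -/
theorem IsQuasiAdequate.not_adequate_iff {H : Subgroup (GL (Fin n) k)} (hq : IsQuasiAdequate H) :
    ¬ Subgroup.IsThorneAdequate H ↔ ¬ H1AdZeroVanishes H := by
  rw [isThorneAdequate_iff_quasi_and_h1]
  exact ⟨fun h h1 => h ⟨hq, h1⟩, fun h h' => h h'.2⟩

/-- The SLAB `ℓ ∣ n` is never quasi-adequate: the scalars sit in `(ad⁰)^H` (tree `Subgroup.adZeroRep_invariants_ne_bot`), clause (ii) fails. -/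
theorem not_isQuasiAdequate_of_natCast_eq_zero (H : Subgroup (GL (Fin n) k)) (hn : (n : k) = 0) (hn0 : 0 < n) : ¬ IsQuasiAdequate H :=
  fun h => Subgroup.adZeroRep_invariants_ne_bot H hn hn0 h.2.1

variable {X : Type*} [Group X]

/-- `J` lies **above the perfect core** of `I`: `J` contains every perfect subgroup of `I` (first-order; no `∃ P`). -/
def AboveCore (I J : Subgroup X) : Prop :=
  ∀ Q : Subgroup X, Q ≤ I → ⁅Q, Q⁆ = Q → Q ≤ J

/-- `AboveCore I J ↔ perfectCore I ≤ J` (the perfect core is the join of the perfect subgroups — g11 tree def `Theorems.CoreAdequacy.perfectCore`). -/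
theorem aboveCore_iff_perfectCore_le {I J : Subgroup X} : AboveCore I J ↔ perfectCore I ≤ J := by
  constructor
  · intro h
    exact sSup_le fun Q hQ => h Q hQ.1 hQ.2
  · intro h Q hQI hQ
    exact (le_sSup (s := {Q : Subgroup X | Q ≤ I ∧ ⁅Q, Q⁆ = Q}) ⟨hQI, hQ⟩).trans h

/-- `AboveCore I J ↔ ∃ P, IsPerfectCore I P ∧ P ≤ J` (the g11 form with the core named). -/
theorem aboveCore_iff_exists_isPerfectCore {I J : Subgroup X} : AboveCore I J ↔ ∃ P : Subgroup X, IsPerfectCore I P ∧ P ≤ J := by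
  rw [aboveCore_iff_perfectCore_le]
  exact ⟨fun h => ⟨perfectCore I, isPerfectCore_perfectCore I, h⟩, fun ⟨P, hP, hPJ⟩ => (isPerfectCore_iff_eq.1 hP) ▸ hPJ⟩

/-- `AboveCore` only depends on the perfect core: invariant under passing to a normal subgroup with solvable quotient (g11 KERNEL III, tree
`perfectCore_eq_of_normal_of_isSolvable_quotient`). -/
theorem aboveCore_iff_of_normal_of_isSolvable_quotient {I I' J : Subgroup X} (hle : I' ≤ I) [(I'.subgroupOf I).Normal]
    (hsolv : IsSolvable (I ⧸ I'.subgroupOf I)) : AboveCore I' J ↔ AboveCore I J := by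
  rw [aboveCore_iff_perfectCore_le, aboveCore_iff_perfectCore_le, perfectCore_eq_of_normal_of_isSolvable_quotient hle hsolv]

/-- GROUP-LEVEL DIAL «SQAL»: some layer `J` above the perfect core of `I`, inside `I`, is absolutely irreducible and quasi-adequate. -/
def QuasiAdequateBetween (I : Subgroup (GL (Fin n) k)) : Prop :=
  ∃ J : Subgroup (GL (Fin n) k), AboveCore I J ∧ J ≤ I ∧ IsAbsIrreducible J.subtype ∧ IsQuasiAdequate J

/-- SADQ ⟹ SQAL (an adequate layer is a quasi-adequate layer): the new dial REFINES the g11 residual dial. -/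
theorem quasiAdequateBetween_of_solvAdequateBetween {I : Subgroup (GL (Fin n) k)} (h : SolvAdequateBetween I) : QuasiAdequateBetween I := by
  obtain ⟨P, J, hP, hPJ, hJI, hirr, hadq⟩ := h
  exact ⟨J, aboveCore_iff_exists_isPerfectCore.2 ⟨P, hP, hPJ⟩, hJI, hirr, IsQuasiAdequate.of_isThorneAdequate hadq⟩

/-- **LIE LAYER.**  If `I` has a quasi-adequate absolutely irreducible layer above its core but NO adequate one (the RSL ∧ SQAL situation), then that
layer carries a NON-ZERO class in `H¹(J, ad⁰)` — the source of Khare–Thorne's Lie classes in dual Selmer. -/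
theorem lie_layer_of_quasi_of_not_solvAdequate {I : Subgroup (GL (Fin n) k)} (hq : QuasiAdequateBetween I) (hs : ¬ SolvAdequateBetween I) :
    ∃ J : Subgroup (GL (Fin n) k), AboveCore I J ∧ J ≤ I ∧ IsAbsIrreducible J.subtype ∧ IsQuasiAdequate J ∧ ¬ H1AdZeroVanishes J := by
  obtain ⟨J, hPJ, hJI, hirr, hqJ⟩ := hq
  refine ⟨J, hPJ, hJI, hirr, hqJ, fun h1 => hs ?_⟩
  obtain ⟨P, hP, hPJ'⟩ := aboveCore_iff_exists_isPerfectCore.1 hPJ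
  exact ⟨P, J, hP, hPJ', hJI, hirr, (isThorneAdequate_iff_quasi_and_h1 J).2 ⟨hqJ, h1⟩⟩

/-- Conversely an SQAL image whose every quasi-adequate layer has `H¹(J, ad⁰) = 0` is solvably adequate (so NOT an RSL image). -/
theorem solvAdequateBetween_of_quasi_of_h1 {I : Subgroup (GL (Fin n) k)} (hq : QuasiAdequateBetween I)
    (h1 : ∀ J : Subgroup (GL (Fin n) k), AboveCore I J → J ≤ I → IsAbsIrreducible J.subtype → IsQuasiAdequate J → H1AdZeroVanishes J) :
    SolvAdequateBetween I := by
  by_contra hs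
  obtain ⟨J, hPJ, hJI, hirr, hqJ, hne⟩ := lie_layer_of_quasi_of_not_solvAdequate hq hs
  exact hne (h1 J hPJ hJI hirr hqJ)

/-- **ORBIT MONOTONICITY** (KERNEL V): a normal subgroup `I' ◁ I` with solvable quotient has the same perfect core, so a quasi-adequate layer for `I'`
is one for `I`.  (Quasi-adequacy is a property of the layer `J` alone; only «above the core» and `J ≤ I` refer to `I`.) -/
theorem QuasiAdequateBetween.of_normal_of_isSolvable_quotient {I I' : Subgroup (GL (Fin n) k)} (hle : I' ≤ I) [(I'.subgroupOf I).Normal]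
    (hsolv : IsSolvable (I ⧸ I'.subgroupOf I)) (h : QuasiAdequateBetween I') : QuasiAdequateBetween I := by
  obtain ⟨J, hPJ, hJI, hirr, hq⟩ := h
  exact ⟨J, (aboveCore_iff_of_normal_of_isSolvable_quotient hle hsolv).1 hPJ, hJI.trans hle, hirr, hq⟩

/-- The DEGENERATE dial descends: `¬ QuasiAdequateBetween I → ¬ QuasiAdequateBetween I'` for `I' ◁ I` with solvable quotient — the residual cell DEG
is inherited by every solvable Galois restriction (R2: no DEG instance is reachable from LIE by the kit's solvable moves). -/
theorem not_quasiAdequateBetween_of_normal_of_isSolvable_quotient {I I' : Subgroup (GL (Fin n) k)} (hle : I' ≤ I) [(I'.subgroupOf I).Normal]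
    (hsolv : IsSolvable (I ⧸ I'.subgroupOf I)) (h : ¬ QuasiAdequateBetween I) : ¬ QuasiAdequateBetween I' :=
  fun h' => h (h'.of_normal_of_isSolvable_quotient hle hsolv)

/-- In the slab `ℓ ∣ n` no layer is quasi-adequate: the slab rows of RSL are DEG rows. -/
theorem not_quasiAdequateBetween_of_natCast_eq_zero (I : Subgroup (GL (Fin n) k)) (hn : (n : k) = 0) (hn0 : 0 < n) : ¬ QuasiAdequateBetween I := by
  rintro ⟨J, -, -, -, hq⟩
  exact not_isQuasiAdequate_of_natCast_eq_zero J hn hn0 hq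

end QuasiAdequate

/-! ## §2 The field-level dial SQAL (the vocabulary is the landed g11 twin `Theorems.CoreAdequacy`, used BY NAME) -/

section Cells

/-- NEW DIAL «SQAL» — **solvably quasi-adequate image**: some (⟺ every, Brauer–Nesbitt) absolutely irreducible reduction `τ` of `ρ|Γ_{K(ζ_ℓ)}` has a
layer `J` above the perfect core of its image, inside the image, absolutely irreducible and QUASI-ADEQUATE (clauses (i), (ii), (iv)).  By the Galois
correspondence (g11 memo §3) such `J` are exactly the residual images over the layers `M` of the finite solvable Galois hulls of `K` inside
`K(ρ̄, ζ_ℓ)`: «after some solvable base change every NON-COHOMOLOGICAL hypothesis of the Taylor–Wiles image condition holds». -/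
def SolvablyQuasiAdequateImage {K : Type} [Field K] [NumberField K] {ℓ : ℕ} [Fact ℓ.Prime] {n : ℕ}
    (ρ : FramedGaloisRep K (PadicAlgCl ℓ) n) : Prop :=
  ∃ τ : Field.absoluteGaloisGroup (CyclotomicField ℓ K) →* GL (Fin n) (padicAlgClResidueField ℓ),
    (ρ.restrictField (CyclotomicField ℓ K)).IsReductionOf (RingHom.id _) τ ∧ IsAbsIrreducible τ ∧
      ∃ J : Subgroup (GL (Fin n) (padicAlgClResidueField ℓ)), AboveCore τ.range J ∧ J ≤ τ.range ∧ IsAbsIrreducible J.subtype ∧ IsQuasiAdequate J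

/-- The field-level dial is the group-level predicate on the image (definitional). -/
theorem solvablyQuasiAdequateImage_iff {K : Type} [Field K] [NumberField K] {ℓ : ℕ} [Fact ℓ.Prime] {n : ℕ}
    (ρ : FramedGaloisRep K (PadicAlgCl ℓ) n) :
    SolvablyQuasiAdequateImage ρ ↔ ∃ τ : Field.absoluteGaloisGroup (CyclotomicField ℓ K) →* GL (Fin n) (padicAlgClResidueField ℓ),
      (ρ.restrictField (CyclotomicField ℓ K)).IsReductionOf (RingHom.id _) τ ∧ IsAbsIrreducible τ ∧ QuasiAdequateBetween τ.range := Iff.rfl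

/-- SQAL refines CycIrr (it quantifies an absolutely irreducible reduction). -/
theorem cycIrr_of_solvablyQuasiAdequateImage {K : Type} [Field K] [NumberField K] {ℓ : ℕ} [Fact ℓ.Prime] {n : ℕ}
    {ρ : FramedGaloisRep K (PadicAlgCl ℓ) n} (h : SolvablyQuasiAdequateImage ρ) : CycIrr ρ := by
  obtain ⟨τ, hτ, hirr, _⟩ := h
  exact ⟨τ, hτ, hirr⟩

/-- SADQ ⟹ SQAL at the field level (so SQAL ∨ ¬SQAL is an honest cut OF THE RESIDUAL ¬SADQ, not of F†). -/
theorem solvablyQuasiAdequateImage_of_solvablyAdequateImage {K : Type} [Field K] [NumberField K] {ℓ : ℕ} [Fact ℓ.Prime] {n : ℕ}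
    {ρ : FramedGaloisRep K (PadicAlgCl ℓ) n} (h : SolvablyAdequateImage ρ) : SolvablyQuasiAdequateImage ρ := by
  obtain ⟨τ, hτ, hirr, hS⟩ := (solvablyAdequateImage_iff ρ).1 h
  exact ⟨τ, hτ, hirr, quasiAdequateBetween_of_solvAdequateBetween hS⟩

/-- **THE LIE INSTANCE LEMMA**: an RSL instance (no adequate layer at ANY reduction) with SQAL carries, at the SQAL reduction, a quasi-adequate
absolutely irreducible layer `J` with `H¹(J, ad⁰) ≠ 0`. -/
theorem lie_layer_of_instance {K : Type} [Field K] [NumberField K] {ℓ : ℕ} [Fact ℓ.Prime] {n : ℕ}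
    {ρ : FramedGaloisRep K (PadicAlgCl ℓ) n} (hS : ¬ SolvablyAdequateImage ρ) (hQ : SolvablyQuasiAdequateImage ρ) :
    ∃ τ : Field.absoluteGaloisGroup (CyclotomicField ℓ K) →* GL (Fin n) (padicAlgClResidueField ℓ),
      (ρ.restrictField (CyclotomicField ℓ K)).IsReductionOf (RingHom.id _) τ ∧ IsAbsIrreducible τ ∧
        ∃ J : Subgroup (GL (Fin n) (padicAlgClResidueField ℓ)), AboveCore τ.range J ∧ J ≤ τ.range ∧ IsAbsIrreducible J.subtype ∧
          IsQuasiAdequate J ∧ ¬ H1AdZeroVanishes J := by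
  obtain ⟨τ, hτ, hirr, hq⟩ := (solvablyQuasiAdequateImage_iff ρ).1 hQ
  have hs : ¬ SolvAdequateBetween τ.range := fun h => hS ((solvablyAdequateImage_iff ρ).2 ⟨τ, hτ, hirr, h⟩)
  exact ⟨τ, hτ, hirr, lie_layer_of_quasi_of_not_solvAdequate hq hs⟩

/-- The slab `ℓ ∣ n` (i.e. `(n : 𝔽) = 0` in the residue field) has no SQAL instance: its RSL rows are DEG rows. -/
theorem not_solvablyQuasiAdequateImage_of_natCast_eq_zero {K : Type} [Field K] [NumberField K] {ℓ : ℕ} [Fact ℓ.Prime] {n : ℕ}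
    (ρ : FramedGaloisRep K (PadicAlgCl ℓ) n) (hn : (n : padicAlgClResidueField ℓ) = 0) (hn0 : 0 < n) : ¬ SolvablyQuasiAdequateImage ρ := by
  rintro ⟨τ, -, -, hq⟩
  exact not_quasiAdequateBetween_of_natCast_eq_zero τ.range hn hn0 hq

/-- The TREE ROUTE decl of the target IS the landed structured RSL (definitional). -/
theorem rsl_route_iff_tree : CoreAdequacySplit.NoAdequateLayerLifting ↔ NoAdequateLayerLifting := Iff.rfl

/-! ## §2b The R1 CARVE «D↓» (critic CLEARED row 189 (F2), notice of record) and the THREE cells -/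

/-- The geometric clause of `LiftTail` / Serre_w for a framed representation (a.e. unramified ∧ de Rham above ℓ for Fontaine's pinned datum), verbatim. -/
def Geometric {F : Type} [Field F] [NumberField F] {ℓ : ℕ} [Fact ℓ.Prime] {m : ℕ} (r : FramedGaloisRep F (PadicAlgCl ℓ) m) : Prop :=
  (∀ᶠ v : IsDedekindDomain.HeightOneSpectrum (NumberField.RingOfIntegers F) in cofinite, r.IsUnramifiedAt v) ∧
    ∀ (v : IsDedekindDomain.HeightOneSpectrum (NumberField.RingOfIntegers F)) (hv : ((ℓ : ℕ) : NumberField.RingOfIntegers F) ∈ v.asIdeal),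
      (Literature.NumberTheory.PAdicHodge.fontainePstAdicCompletion v ℓ hv).IsDeRhamFramed (r.toLocal v)

/-- NEW CARVE «D↓» `SolvableDescentShadow ρ` — **the downward solvable-descent shadow** (critic row 189 (F2), R1 notice of record «the residual books
no kit-closable sub-box», mirror image of the parent's UPWARD bridge TRANS): `ρ` is, in the trace currency of CSD / AUT↑, a twist `ρ₀|_{Γ_K} ⊗ χ` of the
restriction along a finite SOLVABLE GALOIS `K/K₀` of an irreducible geometric `ρ₀ : Γ_{K₀} → GL_n(ℚ̄_ℓ)` whose residual image over `K₀(ζ_ℓ)` is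
absolutely irreducible and Thorne-adequate or has an adequate layer (ADQ ∨ SADQ over K₀ — the parent's ENGINE / BRIDGE boxes), `χ` a geometric ℓ-adic
character of `Γ_K`.  `K₀ = K` is allowed (that slice is empty inside the RSL box up to scalars, BLGG13 Lemma 6.1.4).  Such instances are closed by the
parent's kit run DOWNWARD (support `SolvableDescentTransport`), so they must not be booked in the residual. -/
def SolvableDescentShadow {K : Type} [Field K] [NumberField K] {ℓ : ℕ} [Fact ℓ.Prime] {n : ℕ} (ρ : FramedGaloisRep K (PadicAlgCl ℓ) n) : Prop :=
  ∃ (K₀ : Type) (_ : Field K₀) (_ : NumberField K₀) (_ : Algebra K₀ K), IsGalois K₀ K ∧ IsSolvable (K ≃ₐ[K₀] K) ∧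
    ∃ (ρ₀ : FramedGaloisRep K₀ (PadicAlgCl ℓ) n) (χ : FramedGaloisRep K (PadicAlgCl ℓ) 1),
      ρ₀.toGaloisRep.IsIrreducible ∧ Geometric ρ₀ ∧ Geometric χ ∧ CycIrr ρ₀ ∧ (AdequateCyclotomicImage ρ₀ ∨ SolvablyAdequateImage ρ₀) ∧
        ∀ g : Field.absoluteGaloisGroup K, FramedRep.trace ρ g = FramedRep.trace χ g * FramedRep.trace (ρ₀.restrictField K) g

/-- The D↓ literal of the route one-liners is `SolvableDescentShadow ρ` (definitional). -/
theorem dsh_clause_iff (K : Type) [Field K] [NumberField K] (n ℓ : ℕ) [Fact ℓ.Prime] (ρ : FramedGaloisRep K (PadicAlgCl ℓ) n) :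
    (∃ (K₀ : Type) (_ : Field K₀) (_ : NumberField K₀) (_ : Algebra K₀ K), IsGalois K₀ K ∧ IsSolvable (K ≃ₐ[K₀] K) ∧ ∃ (ρ₀ : Literature.NumberTheory.GaloisRepresentations.FramedGaloisRep K₀ (PadicAlgCl ℓ) n) (χ : Literature.NumberTheory.GaloisRepresentations.FramedGaloisRep K (PadicAlgCl ℓ) 1), ρ₀.toGaloisRep.IsIrreducible ∧ ((∀ᶠ v : IsDedekindDomain.HeightOneSpectrum (NumberField.RingOfIntegers K₀) in cofinite, ρ₀.IsUnramifiedAt v) ∧ ∀ (v : IsDedekindDomain.HeightOneSpectrum (NumberField.RingOfIntegers K₀)) (hv : ((ℓ : ℕ) : NumberField.RingOfIntegers K₀) ∈ v.asIdeal), (Literature.NumberTheory.PAdicHodge.fontainePstAdicCompletion v ℓ hv).IsDeRhamFramed (ρ₀.toLocal v)) ∧ ((∀ᶠ v : IsDedekindDomain.HeightOneSpectrum (NumberField.RingOfIntegers K) in cofinite, χ.IsUnramifiedAt v) ∧ ∀ (v : IsDedekindDomain.HeightOneSpectrum (NumberField.RingOfIntegers K)) (hv : ((ℓ : ℕ) :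 NumberField.RingOfIntegers K) ∈ v.asIdeal), (Literature.NumberTheory.PAdicHodge.fontainePstAdicCompletion v ℓ hv).IsDeRhamFramed (χ.toLocal v)) ∧ Summit.Langlands.Langlands.Theorems.CoreAdequacy.CycIrr ρ₀ ∧ (Summit.Langlands.Langlands.Theorems.CoreAdequacy.AdequateCyclotomicImage ρ₀ ∨ Summit.Langlands.Langlands.Theorems.CoreAdequacy.SolvablyAdequateImage ρ₀) ∧ ∀ g : Field.absoluteGaloisGroup K, Literature.NumberTheory.GaloisRepresentations.FramedRep.trace ρ g = Literature.NumberTheory.GaloisRepresentations.FramedRep.trace χ g * Literature.NumberTheory.GaloisRepresentations.FramedRep.trace (ρ₀.restrictField K) g) ↔ SolvableDescentShadow ρ := Iff.rfl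

/-- **SBL↓ — DESCENT-SHADOW LIFTING** (bridge cell, NOT an item: it is the conclusion of the support `SolvableDescentTransport`): RSL on the instances IN the
shadow D↓.  WEAKER than RSL (`cells_of_rsl`). -/
def DescentShadowLifting : Prop :=
  ∀ (K : Type) [Field K] [NumberField K] (n : ℕ) (hcpt : Literature.NumberTheory.Automorphic.isCompact_glFiniteIntegralLevel n K), 0 < n →
    LiftBelow n → ∀ (ℓ : ℕ) [Fact ℓ.Prime] (ι : PadicAlgCl ℓ ≃+* ℂ) (ρ : FramedGaloisRep K (PadicAlgCl ℓ) n),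
      ℓ < 2 * (n + 1) → CycIrr ρ → ¬ AdequateCyclotomicImage ρ → ¬ SolvablyAdequateImage ρ → SolvableDescentShadow ρ →
        ¬ Theorems.BrightMate.SolvablyReducible ρ → ¬ Theorems.BrightMate.SolvablyMated ι ρ → LiftTail K n hcpt ℓ ι ρ

/-- **LIE — LIE-OBSTRUCTED NO-ADEQUATE-LAYER LIFTING** (cell 1; crux; WEAKER than RSL; ATTACKABLE-BY-ENGINE): RSL OFF the shadow D↓, on the instances
with a quasi-adequate absolutely irreducible layer above the perfect core — whose only adequacy defect is then a non-zero `H¹(J, ad⁰)`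
(`lie_layer_of_instance`).  Rank-2 rows (census GAP table I-L5g11, CLEARED row 189): projective image PSL₂(𝔽₅) ≅ A₅ over K(ζ₅) at ℓ = 5 ONLY (the
PGL₂(𝔽₅)-image groups are adequate, h¹ = 0).  Engines: the sharp Taylor–Wiles criterion (ε̄-isotypic Chebotarev obstruction; Kisin 2009) and
Khare–Thorne Lie-class killing + automorphy mod p^N (exceptional S₅ at p = 5; a GL₄ ordinary instance); contains every HIGH row ℓ > d outside the
Fermat-solvable corner (GHT15 Thm 1.2/1.3). -/
def LieObstructedLifting : Prop :=
  ∀ (K : Type) [Field K] [NumberField K] (n : ℕ) (hcpt : Literature.NumberTheory.Automorphic.isCompact_glFiniteIntegralLevel n K), 0 < n →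
    LiftBelow n → ∀ (ℓ : ℕ) [Fact ℓ.Prime] (ι : PadicAlgCl ℓ ≃+* ℂ) (ρ : FramedGaloisRep K (PadicAlgCl ℓ) n),
      ℓ < 2 * (n + 1) → CycIrr ρ → ¬ AdequateCyclotomicImage ρ → ¬ SolvablyAdequateImage ρ → ¬ SolvableDescentShadow ρ → SolvablyQuasiAdequateImage ρ →
        ¬ Theorems.BrightMate.SolvablyReducible ρ → ¬ Theorems.BrightMate.SolvablyMated ι ρ → LiftTail K n hcpt ℓ ι ρ

/-- **DEG — DEGENERATE-LAYER NO-ADEQUATE-LAYER LIFTING** (cell 2; crux; WEAKER than RSL; DECLARED RESIDUAL; INSTRUMENTABLE): RSL OFF the shadow D↓, on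
the instances with NO quasi-adequate absolutely irreducible layer above the perfect core — on every layer clause (i), (ii) or (iv) fails or the layer is
reducible: the slab ℓ ∣ n (PROVED `not_solvablyQuasiAdequateImage_of_natCast_eq_zero`; (2,2), (3,3), (4,2) — the dyadic GL₂ world is booked by the
MinimalLevelDescent lineage, not re-cut), the Fermat-solvable type (a) of GHT15 Thm 1.3, the LOW range ℓ ≤ d (n ≥ 3; census rows (4,3): six solvable
imprimitive/tensor classes, SL₂(5):2, …).  No lifting engine in print. -/
def DegenerateLayerLifting : Prop :=
  ∀ (K : Type) [Field K] [NumberField K] (n : ℕ) (hcpt : Literature.NumberTheory.Automorphic.isCompact_glFiniteIntegralLevel n K), 0 < n →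
    LiftBelow n → ∀ (ℓ : ℕ) [Fact ℓ.Prime] (ι : PadicAlgCl ℓ ≃+* ℂ) (ρ : FramedGaloisRep K (PadicAlgCl ℓ) n),
      ℓ < 2 * (n + 1) → CycIrr ρ → ¬ AdequateCyclotomicImage ρ → ¬ SolvablyAdequateImage ρ → ¬ SolvableDescentShadow ρ → ¬ SolvablyQuasiAdequateImage ρ →
        ¬ Theorems.BrightMate.SolvablyReducible ρ → ¬ Theorems.BrightMate.SolvablyMated ι ρ → LiftTail K n hcpt ℓ ι ρ

/-- **TRANS↓ — SOLVABLE DESCENT TRANSPORT** (support; PRINT modulo the parent's kit, all BY NAME on the tree route decls of route-Langlands-CoreAdequacySplit: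
Serre_w over K₀ from OW ∧ RES, the avatar from W⁺, LiftTail(ρ₀) from AIL (ADQ) or TRANS (SADQ) at every level, AUT↑ along the solvable Galois K/K₀
(Arthur–Clozel), CSD at the trivial layer, the twist by the weakly automorphic character χ (IH(1) ∧ Serre_w ∧ W⁺ of the instance; π ⊗ ψ∘det)).  Its
conclusion is the bridge cell SBL↓. -/
def SolvableDescentTransport : Prop :=
  CoreAdequacySplit.OdlyzkoWorldAutomorphy → CoreAdequacySplit.TransOdlyzkoAutomorphy → CoreAdequacySplit.SatakeAvatarExistence → CoreAdequacySplit.SolvableAscentConstituent → CoreAdequacySplit.CliffordSolvableDescent → CoreAdequacySplit.AdequateImageLifting → CoreAdequacySplit.SolvableAdequacyTransport →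
    DescentShadowLifting

/-- FRAME′ — the PARENT ROUTE VERBATIM with RSL abstracted: «RSL → Langlands», i.e. the ten other binders of `CoreAdequacySplit.closes` (AIL, W⁺, AUT↑,
CSD, TRANS, FRAME, OW, RES, BRIGHT, A†) — node kernel `frame_of_parent`.  Support; never staffed on its own. -/
def NoAdequateLayerFrame : Prop :=
  CoreAdequacySplit.NoAdequateLayerLifting → _root_.Langlands

/-! ## §3 KERNEL — RSL ⟺ LIE ∧ DEG ∧ SBL↓ (TWO excluded middles: on D↓, then on SQAL; no kit; 0 EQUIV layers) -/

/-- The dial regions partition every RSL instance and are pairwise disjoint. -/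
theorem sqal_dichotomy {K : Type} [Field K] [NumberField K] {ℓ : ℕ} [Fact ℓ.Prime] {n : ℕ} (ρ : FramedGaloisRep K (PadicAlgCl ℓ) n) :
    SolvablyQuasiAdequateImage ρ ∨ ¬ SolvablyQuasiAdequateImage ρ := Classical.em _

/-- Excluded middle on the carve D↓. -/
theorem shadow_dichotomy {K : Type} [Field K] [NumberField K] {ℓ : ℕ} [Fact ℓ.Prime] {n : ℕ} (ρ : FramedGaloisRep K (PadicAlgCl ℓ) n) :
    SolvableDescentShadow ρ ∨ ¬ SolvableDescentShadow ρ := Classical.em _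

/-- The three dial regions (D↓ ∣ ¬D↓ ∧ SQAL ∣ ¬D↓ ∧ ¬SQAL) cover every instance. -/
theorem regions_trichotomy {K : Type} [Field K] [NumberField K] {ℓ : ℕ} [Fact ℓ.Prime] {n : ℕ} (ρ : FramedGaloisRep K (PadicAlgCl ℓ) n) :
    SolvableDescentShadow ρ ∨ (¬ SolvableDescentShadow ρ ∧ SolvablyQuasiAdequateImage ρ) ∨ (¬ SolvableDescentShadow ρ ∧ ¬ SolvablyQuasiAdequateImage ρ) := by
  rcases shadow_dichotomy ρ with h | h
  · exact Or.inl h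
  rcases sqal_dichotomy ρ with h' | h'
  · exact Or.inr (Or.inl ⟨h, h'⟩)
  · exact Or.inr (Or.inr ⟨h, h'⟩)

/-- The three dial regions are pairwise disjoint. -/
theorem regions_disjoint {K : Type} [Field K] [NumberField K] {ℓ : ℕ} [Fact ℓ.Prime] {n : ℕ} (ρ : FramedGaloisRep K (PadicAlgCl ℓ) n) :
    ¬ (SolvableDescentShadow ρ ∧ (¬ SolvableDescentShadow ρ ∧ SolvablyQuasiAdequateImage ρ)) ∧
    ¬ (SolvableDescentShadow ρ ∧ (¬ SolvableDescentShadow ρ ∧ ¬ SolvablyQuasiAdequateImage ρ)) ∧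
    ¬ ((¬ SolvableDescentShadow ρ ∧ SolvablyQuasiAdequateImage ρ) ∧ (¬ SolvableDescentShadow ρ ∧ ¬ SolvablyQuasiAdequateImage ρ)) :=
  ⟨fun h => h.2.1 h.1, fun h => h.2.1 h.1, fun h => h.2.2 h.1.2⟩

/-- RSL ⟹ each cell OUTRIGHT (each is RSL on a sub-box). -/
theorem cells_of_rsl (h : NoAdequateLayerLifting) : LieObstructedLifting ∧ DegenerateLayerLifting ∧ DescentShadowLifting :=
  ⟨fun K _ _ n hcpt hn ih ℓ _ ι ρ hlt hc hA hS _ _ => h K n hcpt hn ih ℓ ι ρ hlt hc hA hS,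
    fun K _ _ n hcpt hn ih ℓ _ ι ρ hlt hc hA hS _ _ => h K n hcpt hn ih ℓ ι ρ hlt hc hA hS,
    fun K _ _ n hcpt hn ih ℓ _ ι ρ hlt hc hA hS _ => h K n hcpt hn ih ℓ ι ρ hlt hc hA hS⟩

/-- LIE ∧ DEG ∧ SBL↓ ⟹ RSL (case split on D↓, then on SQAL). -/
theorem rsl_of_cells (hL : LieObstructedLifting) (hD : DegenerateLayerLifting) (hB : DescentShadowLifting) : NoAdequateLayerLifting := by
  intro K _ _ n hcpt hn ih ℓ _ ι ρ hlt hc hA hS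
  rcases shadow_dichotomy ρ with hDs | hDs
  · exact hB K n hcpt hn ih ℓ ι ρ hlt hc hA hS hDs
  rcases sqal_dichotomy ρ with hQ | hQ
  · exact hL K n hcpt hn ih ℓ ι ρ hlt hc hA hS hDs hQ
  · exact hD K n hcpt hn ih ℓ ι ρ hlt hc hA hS hDs hQ

/-- **THE NODE: RSL ⟺ LIE ∧ DEG ∧ SBL↓** (outright). -/
theorem rsl_iff_cells : NoAdequateLayerLifting ↔ LieObstructedLifting ∧ DegenerateLayerLifting ∧ DescentShadowLifting :=
  ⟨cells_of_rsl, fun h => rsl_of_cells h.1 h.2.1 h.2.2⟩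

/-- The same on the TREE ROUTE decl `CoreAdequacySplit.NoAdequateLayerLifting` (stmt-Langlands-27954), by name. -/
theorem NoAdequateLayerLifting_route_iff_cells :
    CoreAdequacySplit.NoAdequateLayerLifting ↔ LieObstructedLifting ∧ DegenerateLayerLifting ∧ DescentShadowLifting :=
  rsl_route_iff_tree.trans rsl_iff_cells

/-- Cells ⟹ RSL on the TREE ROUTE decl (closing direction, by name). -/
theorem rsl_of_cells' (h : LieObstructedLifting ∧ DegenerateLayerLifting ∧ DescentShadowLifting) : CoreAdequacySplit.NoAdequateLayerLifting :=
  NoAdequateLayerLifting_route_iff_cells.2 h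

/-- SBL↓ from TRANS↓ and the parent's seven kit binders (BY NAME). -/
theorem shadow_of_transport (hTd : SolvableDescentTransport) (h0 : CoreAdequacySplit.OdlyzkoWorldAutomorphy) (h1 : CoreAdequacySplit.TransOdlyzkoAutomorphy) (h2 : CoreAdequacySplit.SatakeAvatarExistence) (h3 : CoreAdequacySplit.SolvableAscentConstituent) (h4 : CoreAdequacySplit.CliffordSolvableDescent) (h5 : CoreAdequacySplit.AdequateImageLifting) (h6 : CoreAdequacySplit.SolvableAdequacyTransport) : DescentShadowLifting :=
  hTd h0 h1 h2 h3 h4 h5 h6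

/-! ## §4 ROOT — deciding theorems concluding `_root_.Langlands` (parent route theorem `CoreAdequacySplit.closes` BY NAME) -/

/-- FRAME′ from the parent: the ten other binders of `CoreAdequacySplit.closes` give «RSL → Langlands». -/
theorem frame_of_parent (h₁ : CoreAdequacySplit.AdequateImageLifting) (hW : CoreAdequacySplit.SatakeAvatarExistence)
    (hUp : CoreAdequacySplit.SolvableAscentConstituent) (hDown : CoreAdequacySplit.CliffordSolvableDescent)
    (hT : CoreAdequacySplit.SolvableAdequacyTransport) (hF : CoreAdequacySplit.SmallPrimeLiftingFrame)
    (hOW : CoreAdequacySplit.OdlyzkoWorldAutomorphy) (hRES : CoreAdequacySplit.TransOdlyzkoAutomorphy)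
    (hB : CoreAdequacySplit.DensityOneCyclotomicBrightness) (hA : CoreAdequacySplit.IrreducibleLargePrimeLifting) : NoAdequateLayerFrame :=
  fun h₃ => CoreAdequacySplit.closes h₁ h₃ hW hUp hDown hT hF hOW hRES hB hA

/-- `closes` — ROOT form over the PARENT's tree binders (BY NAME) + the two new cruxes + TRANS↓: 13 binders, conclusion `_root_.Langlands`. -/
theorem closes (hL : LieObstructedLifting) (hD : DegenerateLayerLifting) (hTd : SolvableDescentTransport)
    (h₁ : CoreAdequacySplit.AdequateImageLifting) (hW : CoreAdequacySplit.SatakeAvatarExistence)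
    (hUp : CoreAdequacySplit.SolvableAscentConstituent) (hDown : CoreAdequacySplit.CliffordSolvableDescent)
    (hT : CoreAdequacySplit.SolvableAdequacyTransport) (hF : CoreAdequacySplit.SmallPrimeLiftingFrame)
    (hOW : CoreAdequacySplit.OdlyzkoWorldAutomorphy) (hRES : CoreAdequacySplit.TransOdlyzkoAutomorphy)
    (hB : CoreAdequacySplit.DensityOneCyclotomicBrightness) (hA : CoreAdequacySplit.IrreducibleLargePrimeLifting) : _root_.Langlands :=
  CoreAdequacySplit.closes h₁ (rsl_of_cells' ⟨hL, hD, hTd hOW hRES hW hUp hDown h₁ hT⟩) hW hUp hDown hT hF hOW hRES hB hA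

/-- `closes_framed` — the CHILD ROUTE's deciding theorem: 11 binders LIE, DEG, TRANS↓, OW, RES, W⁺, AUT↑, CSD, AIL, TRANS, FRAME′ — all used. -/
theorem closes_framed (hL : LieObstructedLifting) (hD : DegenerateLayerLifting) (hTd : SolvableDescentTransport)
    (hOW : CoreAdequacySplit.OdlyzkoWorldAutomorphy) (hRES : CoreAdequacySplit.TransOdlyzkoAutomorphy) (hW : CoreAdequacySplit.SatakeAvatarExistence)
    (hUp : CoreAdequacySplit.SolvableAscentConstituent) (hDown : CoreAdequacySplit.CliffordSolvableDescent) (h₁ : CoreAdequacySplit.AdequateImageLifting)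
    (hT : CoreAdequacySplit.SolvableAdequacyTransport) (hF : NoAdequateLayerFrame) : _root_.Langlands :=
  hF (rsl_of_cells' ⟨hL, hD, hTd hOW hRES hW hUp hDown h₁ hT⟩)

/-! ## §5 NECESSITY — every cell is implied by `_root_.Langlands` (WEAKER, never costume-by-strength) -/

namespace Cert

/- S ⟹ RSL is LANDED: `Summit.Langlands.Langlands.Theorems.CoreAdequacy.Cert.rsl_of_langlands` (Theorems/CoreAdequacySplitKernel.lean) — used by name below. -/
/-- S ⟹ LIE. -/
theorem lie_of_langlands (hS : _root_.Langlands) : LieObstructedLifting := (cells_of_rsl (_root_.Summit.Langlands.Langlands.Theorems.CoreAdequacy.Cert.rsl_of_langlands hS)).1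
/-- S ⟹ DEG. -/
theorem deg_of_langlands (hS : _root_.Langlands) : DegenerateLayerLifting := (cells_of_rsl (_root_.Summit.Langlands.Langlands.Theorems.CoreAdequacy.Cert.rsl_of_langlands hS)).2.1
/-- S ⟹ SBL↓. -/
theorem shadow_of_langlands (hS : _root_.Langlands) : DescentShadowLifting := (cells_of_rsl (_root_.Summit.Langlands.Langlands.Theorems.CoreAdequacy.Cert.rsl_of_langlands hS)).2.2
/-- S ⟹ TRANS↓ (its conclusion is Langlands-implied). -/
theorem transport_of_langlands (hS : _root_.Langlands) : SolvableDescentTransport := fun _ _ _ _ _ _ _ => shadow_of_langlands hS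
/-- S ⟹ FRAME′ (trivially; support, never staffed). -/
theorem frame_of_langlands (hS : _root_.Langlands) : NoAdequateLayerFrame := fun _ => hS
/-- RSL ⟹ each cell by name on the ROUTE decl (each cell is a sub-box of the residual it refines). -/
theorem lie_of_rsl (h : CoreAdequacySplit.NoAdequateLayerLifting) : LieObstructedLifting := (cells_of_rsl (rsl_route_iff_tree.1 h)).1
/-- RSL ⟹ DEG by name on the ROUTE decl. -/
theorem deg_of_rsl (h : CoreAdequacySplit.NoAdequateLayerLifting) : DegenerateLayerLifting := (cells_of_rsl (rsl_route_iff_tree.1 h)).2.1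
/-- RSL ⟹ SBL↓ by name on the ROUTE decl. -/
theorem shadow_of_rsl (h : CoreAdequacySplit.NoAdequateLayerLifting) : DescentShadowLifting := (cells_of_rsl (rsl_route_iff_tree.1 h)).2.2

end Cert

end Cells

end Summit.Langlands.Langlands.Theorems.CoreAdequacy.LieDefect
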